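import Summits.CriticalPhenomena.PercolationContinuityZ3.Theorems.PercNearOneGluingNoHeavyQuantSubproductMixture
import HarnessLib

/-!
# QUANT lane R8, T-DEC: THE MEAN-LINE TRANSPORT CERTIFICATE — EVERY width: keep a PAIR of siblings, open one fully and lower the other to the
# mean line; a bipartite transport on the complete graph (node equations, edge inequalities) makes the forest SDEC at the TRUE floor, GIVEN the oracle

builds on p205010 (kernel theorem, internal audit signed; external expert review pending)

Support file (`--supports stmt-CriticalPhenomena-4575`), QUANT lane seat prim-quant-census-1 (gen 27), rung R8 of
`run/shared/lean/prim/quant/LADDER.md`; memo `run/shared/lean/prim/quant/prim-quant-census-1/g27/PAIRFLOW-G27.md` §7.  Theorems only, standard axioms,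
no sorries.  An INSTANCE, for every width, of ✓ `…QuantSubproductMixture` (`sdec_flaw_of_subproductMix`, p503068); the k-general form of
`…QuantMeanLineTriple` (width 3: "drop the third sibling") and the companion of the (hyper-)flow certificates (✓ p513450, ✓ p516187), which it complements:
mean-line columns are floor-legal exactly where boosts are not.

THE COLUMNS.  For an ordered pair `(a, b)` of siblings: DROP all the others, OPEN `a` fully and put `b` at `t_{ab} = (fm − m_a)/m_b` (`fm = fmean L`; the point of
the mean line `o_a m_a + o_b m_b = fm` with `o_a = 1`; legal because `a` is sure; mean exactly `fm`; `t_{ab} ∈ (0,1]` iff `m_a < fm ≤ m_a + m_b`).  The column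
charges only `{a}` (mass `1 − t_{ab}`) and `{a,b}` (mass `t_{ab}`) (`meanLinePair_mass`).  Writing its weight as `m_b·z_{ab}`, a nonnegative `z` is a
sub-product certificate (open sets absorbing every pattern with `≥ 2` elements) iff
    (node a)   `Σ_{b≠a} (m_b − (fm − m_a))·z_{ab} = q_a·Π_{i≠a}(1−qᵢ)`,        (edge ab)   `(fm − m_a)·z_{ab} + (fm − m_b)·z_{ba} ≤ q_a q_b·Π_{i≠a,b}(1−qᵢ)`
— a transportation problem on `K_k` (each node ships its singleton mass to its incident edges, edge capacities = pair masses).  FLOORS: the lowered sibling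
carries the forest floor, `x·m_b ≤ (fm − m_a)·x₁_b`.  CENSUS (exact LP, census-1 g27 `code/kgen_meanline.py`): the family is comparable to and largely disjoint
from the multi-drop boosts — k = 3 equal means 173 vs 115 of 400 (union 215), k = 4 equal means 47 vs 32 of 300 (union 51), k = 4 wide gates 23 vs 41 (union 45);
at width 3 with equal means its feasibility is exactly the pair of Hall conditions of the memo (1330/1330 grid triples).

* **`sdec_flaw_of_meanLineTransport`**: `0 < x < 1`; `L` tree-built, `2 ≤ |L|`; pair means `≥ fm`, single means `< fm`; the floor conditions; a transport
  `z ≥ 0` with the node equations and edge inequalities; the oracle below `fgates L` ⟹ `SDEC x (ftop L) (flaw L)`.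

HONEST STATUS.  A k-general sub-family of the open core; `SiblingStep` ⟺ `GateStepN`, `UPartStep`, `LightResidDECOracle`, `FarTreeRow` remain OPEN; RATE class
(log\*) and the honest sentence of `run/shared/lean/prim/quant/README.md` unchanged.  [this work]; nothing here is cited as a published result.  The gluing rows
served [cite: KozmaNitzan2024, Conjecture 3 (p. 15)]; product measure [cite: Grimmett1999, §1.3 p. 10].
-/

noncomputable section

open scoped BigOperators

namespace Summit.CriticalPhenomena.PercolationContinuityZ3.Theorems
namespace Quant
namespace LawDec

open Finset

/-- **mass of a mean-line pair column**: with `a` opened fully and every other coordinate at `T i`, the sub-product law of `{a, b}` charges the non-empty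
pattern `B` with `1 − T b` if `B = {a}`, with `T b` if `B = {a,b}`, and with nothing otherwise. [this work] -/
theorem meanLinePair_mass {n : ℕ} (T : Fin n → ℝ) (a b : Fin n) (hab : a ≠ b) (B : Finset (Fin n)) (hB : B.Nonempty) :
    (if B ⊆ ({a, b} : Finset (Fin n)) then
        (∏ i ∈ B, (if i = a then (1 : ℝ) else T i)) * ∏ i ∈ ({a, b} : Finset (Fin n)) \ B, (1 - (if i = a then (1 : ℝ) else T i))
      else 0)
      = if B = {a} then 1 - T b else if B = {a, b} then T b else 0 := by
  classical
  have hba : b ≠ a := hab.symm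
  by_cases hsub : B ⊆ ({a, b} : Finset (Fin n))
  · rw [if_pos hsub]
    by_cases ha : a ∈ B
    · by_cases hb : b ∈ B
      · have hBe : B = {a, b} := Finset.Subset.antisymm hsub (by
          intro i hi; rcases Finset.mem_insert.1 hi with rfl | hi
          · exact ha
          · rw [Finset.mem_singleton.1 hi]; exact hb)
        have hne : ({a, b} : Finset (Fin n)) ≠ {a} := by
          intro h; exact hba (Finset.mem_singleton.1 (h ▸ Finset.mem_insert_of_mem (Finset.mem_singleton_self b)))
        rw [hBe, if_neg hne, if_pos rfl, Finset.sdiff_self, Finset.prod_empty, mul_one,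
          Finset.prod_insert (fun h => hab (Finset.mem_singleton.1 h)), Finset.prod_singleton, if_pos rfl, if_neg hba, one_mul]
      · have hBe : B = {a} := by
          refine Finset.Subset.antisymm (fun i hi => ?_) (Finset.singleton_subset_iff.2 ha)
          rcases Finset.mem_insert.1 (hsub hi) with h | h
          · rw [h]; exact Finset.mem_singleton_self a
          · exact absurd (Finset.mem_singleton.1 h ▸ hi) hb
        have hsd : ({a, b} : Finset (Fin n)) \ {a} = {b} := by
          ext i; simp only [Finset.mem_sdiff, Finset.mem_insert, Finset.mem_singleton]
          constructor
          · rintro ⟨h | h, h'⟩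
            · exact absurd h h'
            · exact h
          · intro h; exact ⟨Or.inr h, h.symm ▸ hba⟩
        rw [hBe, if_pos rfl, Finset.prod_singleton, if_pos rfl, hsd, Finset.prod_singleton, if_neg hba, one_mul]
    · have hb : b ∈ B := by
        obtain ⟨i, hi⟩ := hB
        rcases Finset.mem_insert.1 (hsub hi) with h | h
        · exact absurd (h ▸ hi) ha
        · exact Finset.mem_singleton.1 h ▸ hi
      have hBe : B = {b} := by
        refine Finset.Subset.antisymm (fun i hi => ?_) (Finset.singleton_subset_iff.2 hb)
        rcases Finset.mem_insert.1 (hsub hi) with h | h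
        · exact absurd (h ▸ hi) ha
        · exact h
      have hne1 : ({b} : Finset (Fin n)) ≠ {a} := fun h => hba (Finset.mem_singleton.1 (h ▸ Finset.mem_singleton_self b))
      have hne2 : ({b} : Finset (Fin n)) ≠ {a, b} := fun h =>
        hab (Finset.mem_singleton.1 (h.symm ▸ Finset.mem_insert_self a {b}))
      have hsd : ({a, b} : Finset (Fin n)) \ {b} = {a} := by
        ext i; simp only [Finset.mem_sdiff, Finset.mem_insert, Finset.mem_singleton]
        constructor
        · rintro ⟨h | h, h'⟩
          · exact h
          · exact absurd h h'
        · intro h; exact ⟨Or.inl h, h.symm ▸ hab⟩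
      rw [hBe, if_neg hne1, if_neg hne2, hsd, Finset.prod_singleton, Finset.prod_singleton, if_pos rfl, sub_self, mul_zero]
  · rw [if_neg hsub]
    have h1 : B ≠ {a} := fun h => hsub (h ▸ Finset.singleton_subset_iff.2 (Finset.mem_insert_self a {b}))
    have h2 : B ≠ {a, b} := fun h => hsub (h ▸ Finset.Subset.refl _)
    rw [if_neg h1, if_neg h2]

/-- **THE MEAN-LINE TRANSPORT CERTIFICATE (every width; SDEC form, given the oracle).**  See the module docstring. [this work] -/
theorem sdec_flaw_of_meanLineTransport {x : ℝ} (hx0 : 0 < x) (hx1 : x < 1) (L : List Sib)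
    (hL : ∀ t ∈ L, t.TreeOK x) (hn : 2 ≤ L.length)
    (hO : ∀ (x' : ℝ) (n' M' : ℕ) (μ' : ℕ → ℝ), n' < fgates L → TreeBuiltN x' n' M' μ' → SDEC x' M' μ')
    (hpair : ∀ a b : Fin L.length, a ≠ b → fmean L ≤ (L.get a).mean + (L.get b).mean)
    (hlt : ∀ a : Fin L.length, (L.get a).mean < fmean L)
    (hfl2 : ∀ a b : Fin L.length, a ≠ b → x * (L.get b).mean ≤ (fmean L - (L.get a).mean) * (L.get b).x₁)
    (hfl : ∀ i : Fin L.length, x * ∑ l, (L.get l).mean ≤ fmean L * (L.get i).x₁)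
    (z : Fin L.length → Fin L.length → ℝ) (hz0 : ∀ a b, 0 ≤ z a b)
    (hnode : ∀ a : Fin L.length,
      ∑ b ∈ Finset.univ.erase a, ((L.get b).mean - (fmean L - (L.get a).mean)) * z a b
        = (L.get a).q * ∏ i ∈ Finset.univ \ {a}, (1 - (L.get i).q))
    (hedge : ∀ a b : Fin L.length, a ≠ b →
      (fmean L - (L.get a).mean) * z a b + (fmean L - (L.get b).mean) * z b a
        ≤ (L.get a).q * (L.get b).q * ∏ i ∈ Finset.univ \ {a, b}, (1 - (L.get i).q)) :
    SDEC x (ftop L) (flaw L) := by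
  classical
  have hget : ∀ i : Fin L.length, (L.get i).TreeOK x := fun i => hL _ (List.get_mem L i)
  have hL' : ∀ t ∈ L, t.LawOK := fun t ht => (hL t ht).lawOK
  set q : Fin L.length → ℝ := fun i => (L.get i).q with hqdef
  set m : Fin L.length → ℝ := fun i => (L.get i).mean with hmdef
  set y : Fin L.length → ℝ := fun i => (L.get i).x₁ with hydef
  have hq0 : ∀ i, 0 < q i := fun i => (hget i).1
  have hq1 : ∀ i, q i < 1 := fun i => (hget i).2.1
  have hxq : ∀ i, x ≤ q i * y i := fun i => (hget i).2.2.1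
  have hm0 : ∀ i, 0 < m i := fun i => (L.get i).mean_pos (hget i)
  have hy0 : ∀ i, 0 < y i := fun i => by
    obtain ⟨_, _, _, hT, _⟩ := hget i
    exact hT.lawFacts.1
  have hne : L ≠ [] := by
    intro h; have h' := congrArg List.length h; simp only [List.length_nil] at h'; omega
  have hfm0 : 0 < fmean L := fmean_pos_of_ne_nil L hL' hm0 hne
  set fm : ℝ := fmean L with hfmdef
  set Mtot : ℝ := ∑ i, m i with hMtot
  -- lowered opennesses
  set T : Fin L.length → Fin L.length → ℝ := fun a i => (fm - m a) / m i with hTdef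
  have hT0 : ∀ a i, 0 < T a i := fun a i => div_pos (sub_pos.2 (hlt a)) (hm0 i)
  have hT1 : ∀ a i, a ≠ i → T a i ≤ 1 := fun a i h => (div_le_one (hm0 i)).2 (by have := hpair a i h; linarith)
  -- the certificate data
  set PQ : Finset (Fin L.length × Fin L.length) := (Finset.univ : Finset (Fin L.length × Fin L.length)).filter fun p => p.1 ≠ p.2 with hPQ
  set PO : Finset (Finset (Fin L.length)) := (Finset.univ : Finset (Finset (Fin L.length))).filter fun B => 2 ≤ B.card with hPO
  set S : Finset ((Fin L.length × Fin L.length) ⊕ Finset (Fin L.length)) := PQ.image Sum.inl ∪ PO.image Sum.inr with hS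
  set uQ : Fin L.length × Fin L.length → ℝ := fun p => m p.2 * z p.1 p.2 with huQ
  set oQ : Fin L.length × Fin L.length → Fin L.length → ℝ := fun p i => if i = p.1 then 1 else T p.1 i with hoQ
  set PP : Fin L.length × Fin L.length → Finset (Fin L.length) → ℝ := fun p B =>
    if B ⊆ ({p.1, p.2} : Finset (Fin L.length)) then
      (∏ i ∈ B, oQ p i) * ∏ i ∈ ({p.1, p.2} : Finset (Fin L.length)) \ B, (1 - oQ p i) else 0 with hPP
  set piB : Finset (Fin L.length) → ℝ := fun B => (∏ i ∈ B, q i) * ∏ i ∈ Finset.univ \ B, (1 - q i) with hpiB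
  set uO : Finset (Fin L.length) → ℝ := fun B => piB B - ∑ p ∈ PQ, uQ p * PP p B with huO
  set u : (Fin L.length × Fin L.length) ⊕ Finset (Fin L.length) → ℝ := Sum.elim uQ uO with hu
  set E : (Fin L.length × Fin L.length) ⊕ Finset (Fin L.length) → Finset (Fin L.length) :=
    Sum.elim (fun p => ({p.1, p.2} : Finset (Fin L.length))) (fun B => B) with hE
  set o : (Fin L.length × Fin L.length) ⊕ Finset (Fin L.length) → Fin L.length → ℝ := Sum.elim oQ (fun _ _ => 1) with ho
  set v : (Fin L.length × Fin L.length) ⊕ Finset (Fin L.length) → ℝ :=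
    Sum.elim (fun _ => x) (fun _ => x * Mtot / fmean L) with hv
  have hpiB0 : ∀ B, 0 ≤ piB B := fun B =>
    mul_nonneg (Finset.prod_nonneg fun i _ => (hq0 i).le) (Finset.prod_nonneg fun i _ => by linarith [hq1 i])
  have hcase : ∀ c ∈ S, (∃ d j : Fin L.length, d ≠ j ∧ c = Sum.inl (d, j)) ∨
      (∃ B : Finset (Fin L.length), 2 ≤ B.card ∧ c = Sum.inr B) := by
    intro c hc
    rcases Finset.mem_union.1 hc with h | h
    · obtain ⟨p, hp, rfl⟩ := Finset.mem_image.1 h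
      exact Or.inl ⟨p.1, p.2, (Finset.mem_filter.1 hp).2, rfl⟩
    · obtain ⟨B, hB, rfl⟩ := Finset.mem_image.1 h
      exact Or.inr ⟨B, (Finset.mem_filter.1 hB).2, rfl⟩
  have hsumS : ∀ f : (Fin L.length × Fin L.length) ⊕ Finset (Fin L.length) → ℝ,
      ∑ c ∈ S, f c = ∑ p ∈ PQ, f (Sum.inl p) + ∑ B ∈ PO, f (Sum.inr B) := by
    intro f
    rw [hS, Finset.sum_union, Finset.sum_image (fun a _ b _ h => Sum.inl_injective h),
      Finset.sum_image (fun a _ b _ h => Sum.inr_injective h)]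
    rw [Finset.disjoint_left]
    intro c hc hc'
    obtain ⟨p, _, rfl⟩ := Finset.mem_image.1 hc
    obtain ⟨B, _, h⟩ := Finset.mem_image.1 hc'
    exact Sum.inr_ne_inl h
  have hPQsum : ∀ f : Fin L.length × Fin L.length → ℝ, ∑ p ∈ PQ, f p = ∑ d, ∑ j ∈ Finset.univ.erase d, f (d, j) := by
    intro f
    rw [hPQ, Finset.sum_filter, ← Finset.univ_product_univ, Finset.sum_product]
    refine Finset.sum_congr rfl fun d _ => ?_
    rw [← Finset.sum_filter]
    refine Finset.sum_congr ?_ fun j _ => rfl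
    ext j; simp [Finset.mem_erase, eq_comm]
  -- the mass of each column on each non-empty pattern
  have hmass : ∀ p ∈ PQ, ∀ B : Finset (Fin L.length), B.Nonempty →
      PP p B = if B = {p.1} then 1 - T p.1 p.2 else if B = {p.1, p.2} then T p.1 p.2 else 0 := by
    intro p hp B hB
    exact meanLinePair_mass (T p.1) p.1 p.2 (Finset.mem_filter.1 hp).2 B hB
  -- singletons: only the columns opening `c` charge `{c}`
  have hQ1 : ∀ c : Fin L.length, ∑ p ∈ PQ, uQ p * PP p {c} = piB {c} := by
    intro c
    have e : ∀ p ∈ PQ, uQ p * PP p {c} = if p.1 = c then (m p.2 - (fm - m c)) * z c p.2 else 0 := by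
      intro p hp
      have hdj : p.1 ≠ p.2 := (Finset.mem_filter.1 hp).2
      rw [hmass p hp {c} (Finset.singleton_nonempty c)]
      have hne : ({c} : Finset (Fin L.length)) ≠ {p.1, p.2} := fun h =>
        hdj ((Finset.mem_singleton.1 (h.symm ▸ Finset.mem_insert_self p.1 {p.2})).trans
          (Finset.mem_singleton.1 (h.symm ▸ Finset.mem_insert_of_mem (Finset.mem_singleton_self p.2))).symm)
      by_cases hc : p.1 = c
      · rw [if_pos (by rw [hc]), if_pos hc]
        show m p.2 * z p.1 p.2 * (1 - (fm - m p.1) / m p.2) = _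
        have hm2 : m p.2 ≠ 0 := (hm0 p.2).ne'
        rw [hc]; field_simp
      · have hne' : ({c} : Finset (Fin L.length)) ≠ {p.1} := fun h => hc (Finset.singleton_injective h).symm
        rw [if_neg hne', if_neg hne, if_neg hc, mul_zero]
    rw [Finset.sum_congr rfl e, hPQsum]
    have e2 : ∀ d : Fin L.length, ∑ j ∈ Finset.univ.erase d, (if (d, j).1 = c then (m (d, j).2 - (fm - m c)) * z c (d, j).2 else 0)
        = if d = c then ∑ j ∈ Finset.univ.erase c, (m j - (fm - m c)) * z c j else 0 := by
      intro d
      by_cases hd : d = c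
      · subst hd; simp
      · rw [if_neg hd]; exact Finset.sum_eq_zero fun j _ => if_neg hd
    rw [Finset.sum_congr rfl fun d _ => e2 d, Finset.sum_ite_eq' Finset.univ c, if_pos (Finset.mem_univ c)]
    show ∑ j ∈ Finset.univ.erase c, (m j - (fm - m c)) * z c j = (∏ i ∈ ({c} : Finset (Fin L.length)), q i) * ∏ i ∈ Finset.univ \ {c}, (1 - q i)
    rw [Finset.prod_singleton]
    exact hnode c
  -- pairs: only the two columns living on `{a, b}` charge it
  have hQ2 : ∀ a b : Fin L.length, a ≠ b → ∑ p ∈ PQ, uQ p * PP p {a, b} = (fm - m a) * z a b + (fm - m b) * z b a := by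
    intro a b hab
    have hne2 : ({a, b} : Finset (Fin L.length)).Nonempty := ⟨a, Finset.mem_insert_self a {b}⟩
    have hcard : ({a, b} : Finset (Fin L.length)).card = 2 := Finset.card_pair hab
    have e : ∀ p ∈ PQ, uQ p * PP p {a, b} = if p = (a, b) then (fm - m a) * z a b else if p = (b, a) then (fm - m b) * z b a else 0 := by
      intro p hp
      have hdj : p.1 ≠ p.2 := (Finset.mem_filter.1 hp).2
      rw [hmass p hp {a, b} hne2]
      have hne1 : ({a, b} : Finset (Fin L.length)) ≠ {p.1} := by
        intro h; have := congrArg Finset.card h; rw [hcard, Finset.card_singleton] at this; omega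
      rw [if_neg hne1]
      by_cases h1 : p = (a, b)
      · subst h1
        rw [if_pos rfl, if_pos rfl]
        show m b * z a b * ((fm - m a) / m b) = (fm - m a) * z a b
        rw [mul_comm (m b), mul_assoc, mul_div_cancel₀ _ (hm0 b).ne', mul_comm]
      by_cases h2 : p = (b, a)
      · subst h2
        rw [if_pos (Finset.pair_comm b a).symm, if_neg h1, if_pos rfl]
        show m a * z b a * ((fm - m b) / m a) = (fm - m b) * z b a
        rw [mul_comm (m a), mul_assoc, mul_div_cancel₀ _ (hm0 a).ne', mul_comm]
      · have hne3 : ({a, b} : Finset (Fin L.length)) ≠ {p.1, p.2} := by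
          intro h
          have h1' : p.1 ∈ ({a, b} : Finset (Fin L.length)) := h ▸ Finset.mem_insert_self p.1 {p.2}
          have h2' : p.2 ∈ ({a, b} : Finset (Fin L.length)) := h ▸ Finset.mem_insert_of_mem (Finset.mem_singleton_self p.2)
          rcases Finset.mem_insert.1 h1' with e1 | e1 <;> rcases Finset.mem_insert.1 h2' with e2 | e2
          · exact hdj (e1.trans (e2.symm))
          · exact h1 (Prod.ext e1 (Finset.mem_singleton.1 e2))
          · exact h2 (Prod.ext (Finset.mem_singleton.1 e1) e2)
          · exact hdj ((Finset.mem_singleton.1 e1).trans (Finset.mem_singleton.1 e2).symm)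
        rw [if_neg hne3, if_neg h1, if_neg h2, mul_zero]
    rw [Finset.sum_congr rfl e]
    have hmab : (a, b) ∈ PQ := Finset.mem_filter.2 ⟨Finset.mem_univ _, hab⟩
    have hmba : (b, a) ∈ PQ := Finset.mem_filter.2 ⟨Finset.mem_univ _, hab.symm⟩
    have hneq : (a, b) ≠ (b, a) := fun h => hab (Prod.mk.inj h).1
    rw [Finset.sum_eq_add (a, b) (b, a) hneq (fun p _ hp => by rw [if_neg hp.1, if_neg hp.2])
      (fun h => absurd hmab h) (fun h => absurd hmba h), if_pos rfl, if_neg hneq.symm, if_pos rfl]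
  -- larger patterns: no pair column charges them
  have hQ3 : ∀ B : Finset (Fin L.length), 3 ≤ B.card → ∑ p ∈ PQ, uQ p * PP p B = 0 := by
    intro B hB
    refine Finset.sum_eq_zero fun p hp => ?_
    have hdj : p.1 ≠ p.2 := (Finset.mem_filter.1 hp).2
    rw [hmass p hp B (Finset.card_pos.1 (by omega))]
    have h1 : B ≠ {p.1} := by intro h; rw [h, Finset.card_singleton] at hB; omega
    have h2 : B ≠ {p.1, p.2} := by intro h; rw [h, Finset.card_pair hdj] at hB; omega
    rw [if_neg h1, if_neg h2, mul_zero]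
  have huO0 : ∀ B : Finset (Fin L.length), 2 ≤ B.card → 0 ≤ uO B := by
    intro B hB
    show 0 ≤ piB B - ∑ p ∈ PQ, uQ p * PP p B
    rcases Nat.eq_or_lt_of_le hB with h2 | h3
    · obtain ⟨a, b, hab, rfl⟩ := Finset.card_eq_two.1 h2.symm
      rw [hQ2 a b hab]
      have := hedge a b hab
      show 0 ≤ (∏ i ∈ ({a, b} : Finset (Fin L.length)), q i) * (∏ i ∈ Finset.univ \ {a, b}, (1 - q i)) - _
      rw [Finset.prod_pair hab]
      linarith
    · rw [hQ3 B h3, sub_zero]; exact hpiB0 B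
  -- component means
  have hmeanQ : ∀ d j : Fin L.length, d ≠ j → fmean (subRegate L {d, j} (oQ (d, j))) = fmean L := by
    intro d j hdj
    rw [fmean_subRegate]
    show ∑ i ∈ ({d, j} : Finset (Fin L.length)), (if i = d then 1 else (fm - m d) / m i) * (L.get i).mean = fm
    rw [Finset.sum_insert (fun h => hdj (Finset.mem_singleton.1 h)), Finset.sum_singleton, if_pos rfl, if_neg (Ne.symm hdj)]
    show 1 * m d + (fm - m d) / m j * m j = fm
    rw [div_mul_cancel₀ _ (hm0 j).ne']; ring
  have hmeanO : ∀ B : Finset (Fin L.length), fmean (subRegate L B (fun _ => (1 : ℝ))) = ∑ i ∈ B, m i := by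
    intro B; rw [fmean_subRegate_one]
  refine sdec_flaw_of_subproductMix hx0 hx1 L hL hne hO S u E o ?_ ?_ ?_ ?_ ?_ v ?_ ?_ ?_ ?_
  · intro c hc
    rcases hcase c hc with ⟨d, j, hdj, rfl⟩ | ⟨B, hB, rfl⟩
    · show 0 ≤ m j * z d j; exact mul_nonneg (hm0 j).le (hz0 d j)
    · exact huO0 B hB
  · intro c hc i _
    rcases hcase c hc with ⟨d, j, hdj, rfl⟩ | ⟨B, hB, rfl⟩
    · show 0 < (if i = d then 1 else T d i); split_ifs; exacts [one_pos, hT0 d i]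
    · show (0 : ℝ) < 1; exact one_pos
  · intro c hc i _
    rcases hcase c hc with ⟨d, j, hdj, rfl⟩ | ⟨B, hB, rfl⟩
    · show (if i = d then 1 else T d i) ≤ 1
      split_ifs with h
      · exact le_rfl
      · exact hT1 d i (Ne.symm h)
    · show (1 : ℝ) ≤ 1; exact le_rfl
  · intro c hc
    rcases hcase c hc with ⟨d, j, hdj, rfl⟩ | ⟨B, hB, rfl⟩
    · exact ⟨d, Or.inr (show (if d = d then (1 : ℝ) else T d d) = 1 from if_pos rfl)⟩
    · exact ⟨⟨0, by omega⟩, Or.inr rfl⟩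
  · -- THE PATTERN IDENTITY
    intro A hA
    have hget' : ((∏ i ∈ A, (L.get i).q) * ∏ i ∈ Finset.univ \ A, (1 - (L.get i).q)) = piB A := rfl
    rw [hget', hsumS]
    have hOpart : ∑ B ∈ PO, u (Sum.inr B) *
        (if A ⊆ E (Sum.inr B) then (∏ i ∈ A, o (Sum.inr B) i) * ∏ i ∈ E (Sum.inr B) \ A, (1 - o (Sum.inr B) i) else 0)
        = if 2 ≤ A.card then uO A else 0 := by
      have term : ∀ B ∈ PO, u (Sum.inr B) *
          (if A ⊆ E (Sum.inr B) then (∏ i ∈ A, o (Sum.inr B) i) * ∏ i ∈ E (Sum.inr B) \ A, (1 - o (Sum.inr B) i) else 0)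
          = if B = A then uO A else 0 := by
        intro B _
        show uO B * (if A ⊆ B then (∏ i ∈ A, (1 : ℝ)) * ∏ i ∈ B \ A, (1 - (1 : ℝ)) else 0) = _
        by_cases hBA : B = A
        · rw [hBA, if_pos (Finset.Subset.refl A), if_pos rfl, Finset.sdiff_self, Finset.prod_empty, Finset.prod_const_one]
          ring
        · rw [if_neg hBA]
          by_cases hAB : A ⊆ B
          · obtain ⟨i, hi⟩ : (B \ A).Nonempty := by
              rw [Finset.sdiff_nonempty]; intro hBA'; exact hBA (Finset.Subset.antisymm hBA' hAB)
            rw [if_pos hAB, Finset.prod_eq_zero hi (by norm_num), mul_zero, mul_zero]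
          · rw [if_neg hAB, mul_zero]
      rw [Finset.sum_congr rfl term, Finset.sum_ite_eq']
      by_cases h2 : 2 ≤ A.card
      · have hmemA : A ∈ PO := Finset.mem_filter.2 ⟨Finset.mem_univ A, h2⟩
        rw [if_pos hmemA, if_pos h2]
      · have hmemA : A ∉ PO := fun h => h2 (Finset.mem_filter.1 h).2
        rw [if_neg hmemA, if_neg h2]
    rw [hOpart]
    have hQpart : ∑ p ∈ PQ, u (Sum.inl p) *
        (if A ⊆ E (Sum.inl p) then (∏ i ∈ A, o (Sum.inl p) i) * ∏ i ∈ E (Sum.inl p) \ A, (1 - o (Sum.inl p) i) else 0)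
        = ∑ p ∈ PQ, uQ p * PP p A := rfl
    rw [hQpart]
    by_cases h2 : 2 ≤ A.card
    · rw [if_pos h2]
      show ∑ p ∈ PQ, uQ p * PP p A + (piB A - ∑ p ∈ PQ, uQ p * PP p A) = piB A
      ring
    · rw [if_neg h2, add_zero]
      have hc1 : A.card = 1 := le_antisymm (Nat.lt_succ_iff.1 (Nat.lt_of_not_le h2)) (Finset.card_pos.2 hA)
      obtain ⟨c, hc⟩ : ∃ c, A = {c} := Finset.card_eq_one.1 hc1
      rw [hc]; exact hQ1 c
  · intro c hc
    rcases hcase c hc with ⟨d, j, hdj, rfl⟩ | ⟨B, hB, rfl⟩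
    · exact hx0
    · show 0 < x * Mtot / fmean L
      have hMtot0 : 0 < Mtot := Finset.sum_pos (fun i _ => hm0 i) ⟨⟨0, by omega⟩, Finset.mem_univ _⟩
      positivity
  · intro c hc i _
    rcases hcase c hc with ⟨d, j, hdj, rfl⟩ | ⟨B, hB, rfl⟩
    · show x ≤ (if i = d then 1 else T d i) * (L.get i).x₁
      split_ifs with h
      · subst h; rw [one_mul]; exact (hxq i).trans (mul_le_of_le_one_left (hy0 i).le (hq1 i).le)
      · show x ≤ (fm - m d) / m i * y i
        rw [div_mul_eq_mul_div, le_div_iff₀ (hm0 i)]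
        exact hfl2 d i (Ne.symm h)
    · show x * Mtot / fmean L ≤ 1 * (L.get i).x₁
      rw [one_mul, div_le_iff₀ hfm0]
      calc x * Mtot ≤ fmean L * (L.get i).x₁ := hfl i
        _ = (L.get i).x₁ * fmean L := mul_comm _ _
  · intro c hc
    rcases hcase c hc with ⟨d, j, hdj, rfl⟩ | ⟨B, hB, rfl⟩
    · show x * fmean (subRegate L {d, j} (oQ (d, j))) ≤ fmean L * x
      rw [hmeanQ d j hdj, mul_comm]
    · show x * fmean (subRegate L B (fun _ => (1 : ℝ))) ≤ fmean L * (x * Mtot / fmean L)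
      rw [hmeanO B, mul_div_assoc', mul_div_cancel_left₀ _ hfm0.ne']
      exact mul_le_mul_of_nonneg_left (Finset.sum_le_univ_sum_of_nonneg fun i => (hm0 i).le) hx0.le
  · intro c hc
    rcases hcase c hc with ⟨d, j, hdj, rfl⟩ | ⟨B, hB, rfl⟩
    · show fmean L ≤ fmean (subRegate L {d, j} (oQ (d, j)))
      rw [hmeanQ d j hdj]
    · show fmean L ≤ fmean (subRegate L B (fun _ => (1 : ℝ)))
      rw [hmeanO B]
      obtain ⟨a, ha, b, hb, hab⟩ := Finset.one_lt_card.1 (by omega : 1 < B.card)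
      have hsub : ({a, b} : Finset (Fin L.length)) ⊆ B := by
        intro i hi
        rcases Finset.mem_insert.1 hi with rfl | hi
        · exact ha
        · rw [Finset.mem_singleton.1 hi]; exact hb
      calc fmean L ≤ m a + m b := hpair a b hab
        _ = ∑ i ∈ ({a, b} : Finset (Fin L.length)), m i := (Finset.sum_pair hab).symm
        _ ≤ ∑ i ∈ B, m i := Finset.sum_le_sum_of_subset_of_nonneg hsub fun i _ _ => (hm0 i).le

end LawDec
end Quant
end Summit.CriticalPhenomena.PercolationContinuityZ3.Theorems
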